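import Literature.MathematicalPhysics.QuantumFieldTheory.Balaban1983to89.Beta.BiLaplaceBlockGreen
import Literature.MathematicalPhysics.QuantumFieldTheory.Balaban1983to89.Beta.ResolventComposition

/-!
# `BalabanUV.Beta.FP.BiLaplaceTwoLevel` — road «FP» for binder row D1, DESIGN ROW **GHOST-STEP**, first brick (owner d1-p3 gen 13, `N2B-DESIGN.md` v1.1 §5 (c)):
# **THE TWO-LEVEL LAW OF an2's BLOCK-CONSTRAINED BI-LAPLACIAN SYSTEM IS EXACT** — for `N′ = M·L` and every source `x′`, the difference of the Green columns
# `SbCol_{N′} x′ − SbCol_M x′` is a TEMPERED SOLUTION OF THE FORCE-FREE LEVEL-`M` SYSTEM with block-sum data `blockSum_M (SbCol_{N′} x′)` (multiplier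
# `y ↦ Wb_{N′}(quo_L y, x′) − Wb_M(y, x′)`), hence is THE response of the level-`M` system to those data (tempered uniqueness): NO SLICE DEFECT in the scalar
# (ghost) sector — in contrast with the gauge sector (`TwoLevelDefectClosedForm`: `Γ_{N′} − Γ_M − PQ ≠ 0`); every `d`; UNCONDITIONAL

HONEST DEPENDENCY (page 1, mandatory): continuum YM on T⁴ ⇐ BetaPertH ∧ nine spine estimates (0/9 proved); BetaPertH ⇐ (D1) ∧ (D4) ∧ CAP+tail;
G-an2-4 gates asym, D1 and NE2/3/4.  HONEST FRAMING (cell contract, verbatim): «discharging `BetaPertH` makes Bałaban's UV stability UNCONDITIONAL —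
a real constructive-QFT result; it is NOT the continuum limit and NOT the Clay problem.»  THIS MODULE is [folklore]-grade bookkeeping over an2-g6's
`BiLaplaceBlockKKT` ∕ `BiLaplaceBlockGreen` (`SbCol`, `Wb`, `lapLapN_SbCol`, `blockSum_SbCol`, `unique_of_solvesB`, temperedness) and an5's `isBlockConst_of_mul` pattern.
No `def`, no `def … : Prop`, nothing cited, 0 sorry; 0 estimates of Bałaban's constrained objects; 0∕4 row-D1 binders; NOT the perfect level, NOT the ghost step law
itself, NOT (STEP)∕SDF, NOT D1, NOT BetaPertH, NOT continuum, NOT Clay.  «not in print; our bookkeeping».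
ABSOLUTE RULE (cell charter, verbatim): «No internally-minted statement may enter as a cited fact. Every hypothesis is either kernel-proved in this package or a
verbatim quotation of a PUBLISHED theorem with page reference. The manuscript(s) under audit are NOT citable for their own disputed steps — they are the thing
under adjudication; programme-internal (2001/route/tribunal) claims are never citable.»

WHY (`N2B-DESIGN.md` v1.1 §5).  The owner's g13 modules locate road FP's (STEP) defect `D m` as the second background-jet of the typed slice's linearised
Faddeev–Popov quotient, whose kernel is a sum of words in the columns of an2's `Sb = (P_N L² P_N)⁻¹` (`TwoLevelDefectPairing`).  (SDF) then asks that this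
SCALAR sector obey the step law on its own; the mechanism is that — unlike the gauge sector, whose two-level law carries the slice defect `Σ_y (C_y ⊗ β_y + β_y ⊗ C_y)`
— the scalar block system has NO slice and its two-level law is EXACT.  This file is that exactness at finite level, in an5's `SolvesKKT ∕ decomposition_of_EL` format:
the difference of the two Green columns solves the force-free level-`M` system with the `M`-block sums of the finer-constrained column as data.

CONTENT (every `d`; `N′ = M·L`, `M, L ≥ 1`).
* §1 `quo_quo` (`quo L (quo M x) = quo (M·L) x`), `tempered_sub`.
* §2 **`solvesB_SbCol_sub`**: `SolvesB M 0 (blockSum M (SbCol_{N′} x′)) (SbCol_{N′} x′ − SbCol_M x′) (fun y ↦ Wb_{N′} (quo L y) x′ − Wb_M y x′)`;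
  `tempered_SbCol_sub`, `tempered_Wb_sub`; **`SbCol_sub_eq_of_solvesB`**: any tempered solution `(λ, ω)` of that force-free level-`M` system IS the difference of the columns
  — the two-level law has NO defect: `SbCol_{N′} x′ = SbCol_M x′ + λ`.
Provenance: road «FP» OWNER, unit b2b-balaban-beta-d1-p3 gen 13 (prover-b2b-balaban-beta-d1-p3-g13-0), 2026-08-21; no existing file touched.
-/

noncomputable section

namespace Summit.QuantumFields.BalabanUV.Beta.FP.BiLaplaceTwoLevel

open Literature.MathematicalPhysics.QuantumFieldTheory
open Literature.MathematicalPhysics.QuantumFieldTheory.Balaban1983to89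
open Literature.MathematicalPhysics.QuantumFieldTheory.Balaban1983to89.Beta
open AffineAveraging (Form0 dz codiff₁ box toSite blockSum)
open LatticeForm (quo)
open KKTFluctuationUnique (Tempered0)
open ScalarBlockGreen (δS)
open BiLaplaceBlockKKT (Sb Wb)
open BiLaplaceBlockGreen (SbCol WbCol SolvesB lapLapN_SbCol blockSum_SbCol unique_of_solvesB tempered_SbCol tempered_WbCol)
open B12Sec2to5 (l1 l1_nonneg)

variable {d : ℕ} {N' M L : ℕ} [NeZero N'] [NeZero M]

/-! ## §1 Floor quotients compose; temperedness of differences -/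

omit [NeZero N'] [NeZero M] in
/-- [folklore] `quo L (quo M x) = quo (M·L) x` (floor division by a positive integer composes). -/
theorem quo_quo (x : AffineAveraging.Site (d + 1)) : quo L (quo M x) = quo (M * L) x := by
  funext j
  simp only [quo]
  rw [Int.ediv_ediv_of_nonneg (by positivity)]
  push_cast
  ring_nf

omit [NeZero N'] [NeZero M] in
/-- [folklore] Differences of tempered 0-forms are tempered. -/
theorem tempered_sub {f g : Form0 (d + 1) ℝ} (hf : Tempered0 f) (hg : Tempered0 g) : Tempered0 (fun x => f x - g x) := by
  obtain ⟨Cf, mf, hCf⟩ := hf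
  obtain ⟨Cg, mg, hCg⟩ := hg
  refine ⟨|Cf| + |Cg|, mf + mg, fun x => ?_⟩
  have h1 : (1 : ℝ) ≤ 1 + l1 x := by linarith [l1_nonneg x]
  have hf' : |f x| ≤ |Cf| * (1 + l1 x) ^ (mf + mg) :=
    (hCf x).trans ((mul_le_mul_of_nonneg_right (le_abs_self Cf) (pow_nonneg (by linarith) _)).trans
      (mul_le_mul_of_nonneg_left (pow_le_pow_right₀ h1 (Nat.le_add_right mf mg)) (abs_nonneg _)))
  have hg' : |g x| ≤ |Cg| * (1 + l1 x) ^ (mf + mg) :=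
    (hCg x).trans ((mul_le_mul_of_nonneg_right (le_abs_self Cg) (pow_nonneg (by linarith) _)).trans
      (mul_le_mul_of_nonneg_left (pow_le_pow_right₀ h1 (Nat.le_add_left mg mf)) (abs_nonneg _)))
  calc |f x - g x| ≤ |f x| + |g x| := abs_sub _ _
    _ ≤ (|Cf| + |Cg|) * (1 + l1 x) ^ (mf + mg) := by rw [add_mul]; exact add_le_add hf' hg'

/-! ## §2 The two-level law of the scalar block system is EXACT -/

/-- [our proof] **THE DIFFERENCE OF THE GREEN COLUMNS AT TWO LEVELS SOLVES THE FORCE-FREE LEVEL-`M` SYSTEM**: for `N′ = M·L` and every source `x′`,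
`λ := SbCol_{N′} x′ − SbCol_M x′` satisfies (EL_b) `L(Lλ)(x) = ω(quo_M x) + 0` with the coarse multiplier `ω y = Wb_{N′}(quo_L y, x′) − Wb_M(y, x′)` (the `N′`-block-constant
multiplier of the finer-constrained column is `M`-block-constant, `quo_quo`; the two point masses CANCEL) and (M_b) `blockSum_M λ = blockSum_M (SbCol_{N′} x′)` (`blockSum_SbCol` at level `M`). -/
theorem solvesB_SbCol_sub (hN : N' = M * L) (x' : AffineAveraging.Site (d + 1)) :
    SolvesB M 0 (fun y => blockSum M (SbCol (N := N') x') y)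
      (fun x => SbCol (N := N') x' x - SbCol (N := M) x' x)
      (fun y => Wb (N := N') (quo L y) x' - Wb (N := M) y x') where
  el x := by
    have h1 := congrFun (lapLapN_SbCol (N := N') x') x
    have h2 := congrFun (lapLapN_SbCol (N := M) x') x
    have hlin : codiff₁ (dz (codiff₁ (dz (fun x => SbCol (N := N') x' x - SbCol (N := M) x' x))))
        = fun x => codiff₁ (dz (codiff₁ (dz (SbCol (N := N') x')))) x - codiff₁ (dz (codiff₁ (dz (SbCol (N := M) x')))) x := by
      funext u
      simp only [codiff₁, dz, Finset.sum_sub_distrib]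
      ring
    rw [hlin]
    simp only [h1, h2, Pi.add_apply, BiLaplaceBlockGreen.WbAdj, Pi.zero_apply, add_zero]
    rw [quo_quo (M := M) (L := L) x, ← hN]
    ring
  mean y := by
    simp only [blockSum, Finset.sum_sub_distrib]
    have h0 := blockSum_SbCol (N := M) x' y
    simp only [blockSum] at h0
    rw [h0, sub_zero]

/-- [folklore] The difference of the columns is tempered. -/
theorem tempered_SbCol_sub (x' : AffineAveraging.Site (d + 1)) :
    Tempered0 (fun x => SbCol (N := N') x' x - SbCol (N := M) x' x) :=
  tempered_sub (tempered_SbCol (N := N') x') (tempered_SbCol (N := M) x')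

/-- [folklore] The coarse multiplier of the difference is tempered. -/
theorem tempered_Wb_sub (x' : AffineAveraging.Site (d + 1)) :
    Tempered0 (fun y => Wb (N := N') (quo L y) x' - Wb (N := M) y x') := by
  have h1 : Tempered0 (fun y => Wb (N := N') (quo L y) x') := by
    obtain ⟨C, m, hC⟩ := tempered_WbCol (N := N') x'
    obtain ⟨C0, _, hb⟩ : ∃ C0 : ℝ, 0 ≤ C0 ∧ ∀ y, |Wb (N := N') y x'| ≤ C0 := by
      obtain ⟨δ, C', hδ, hC', h⟩ := BiLaplaceBlockKKT.decay_wB (N := N') (d := d)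
      exact ⟨C', hC', fun y => KKTFluctuationUnique.abs_le_of_decay510 hδ (h (Literature.Probability.LatticeModels.Torus.proj N' x')) _⟩
    exact Tempered0.of_bounded fun y => hb (quo L y)
  exact tempered_sub h1 (tempered_WbCol (N := M) x')

/-- [our proof] **NO DEFECT IN THE SCALAR SECTOR**: any TEMPERED pair `(λ, ω)` solving the force-free level-`M` system with data `blockSum_M (SbCol_{N′} x′)` IS the difference of the
Green columns: `SbCol_{N′} x′ = SbCol_M x′ + λ` — the level-`N′` column is the level-`M` column plus THE level-`M` response to its own `M`-block sums, exactly (an2's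
`unique_of_solvesB`).  Contrast: for the typed gauge resolvents the analogous statement fails by `Σ_y (C_y ⊗ β_y + β_y ⊗ C_y)` (`TwoLevelDefectClosedForm`). -/
theorem SbCol_sub_eq_of_solvesB (hN : N' = M * L) (x' : AffineAveraging.Site (d + 1)) {lam ω : Form0 (d + 1) ℝ}
    (h : SolvesB M 0 (fun y => blockSum M (SbCol (N := N') x') y) lam ω) (hlam : Tempered0 lam) (hω : Tempered0 ω) :
    (∀ x, SbCol (N := N') x' x = SbCol (N := M) x' x + lam x) ∧ ω = fun y => Wb (N := N') (quo L y) x' - Wb (N := M) y x' := by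
  have hu := unique_of_solvesB h (solvesB_SbCol_sub (N' := N') (M := M) (L := L) hN x') hlam hω
    (tempered_SbCol_sub (N' := N') (M := M) x') (tempered_Wb_sub (N' := N') (M := M) (L := L) x')
  refine ⟨fun x => ?_, hu.2⟩
  have hx := congrFun hu.1 x
  linarith

end Summit.QuantumFields.BalabanUV.Beta.FP.BiLaplaceTwoLevel

end
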